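import Summits.Ventures.CertifiedManyBodySolver.Observables.PinningFieldChords
import Literature.MathematicalPhysics.QuantumLattice.GroundStateDensityMatrixSupport
import HarnessLib

/-!
# The pinning-field FLOOR chord at a tangent chemical potential: a mean-density trial cap is `μ`-free,
# and the `μ`-terms CANCEL in the Hellmann–Feynman floor

HONEST FRAMING: finite-field RESPONSE floors (certified once the two input rows are), never an order parameter,
never a phase word; not a superconductivity verdict; every number certified or labelled float.

Venture `CertifiedManyBodySolver`, sourced (`d`-wave pinning-field) programme of the Hubbard ladder (rung CQ,
CQ-TABLE §B1-U «instrument-closure floor at a large field»). Companion of `PinningFieldChords.lean` (the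
row-level Hellmann–Feynman chords `PinFieldResponseFloorAt.of_energyRows`) answering ONE bookkeeping question:
the typed sourced objects are GRAND-CANONICAL (`dWaveSourceTorusTT' L t′ U μ h = H(1,t′,U) − μN − h(Δ_d+Δ_d†)`,
response `dWaveSourceDensityTT' L t′ U μ h`), while the producers of the large-field floor speak of a CANONICAL
density `n` — a certified lower bound at `h = 0` read at mean density `n` with a filling multiplier `μ` (a TANGENT
floor `e(ω) − μ·ρ(ω) ≥ ℓ − n·μ` for the stationary translation-invariant states of every density, i.e. a
grand-canonical floor `(ℓ − nμ)·L² ≤ E₀(A_L(μ, 0))`), and a trial state of mean density exactly `n` (a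
two-cluster density mixture) with sourced energy `≤ u·L²` at field `h`.

* §1 `groundEnergy_dWaveSourceTorusTT'_le_of_meanDensity_trial`: a density matrix `ρ` on the `L`-torus Fock
  space with `tr(ρN) = n·L²` and `Re tr(ρ(H − hO)) ≤ u·L²` caps the GRAND-CANONICAL sourced energy at EVERY
  chemical potential: `E₀(dWaveSourceTorusTT' L t′ U μ h) ≤ (u − n·μ)·L²` (variational principle
  `groundEnergy_le_re_trace_mul_of_isDensityMatrix`; the `μ`-dependence is the explicit affine term). Row form
  `sourcedTorusEnergyUpperRow_of_meanDensity_trial` (rational `μ, u, n`).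
* §2 `PinFieldResponseFloorAt.of_tangentRow_of_meanDensityCap`: a tangent floor row
  `SourcedEnergyLowerRow t′ U μ 0 q L₀ (ℓ − nμ)` at `h = 0` and a mean-density cap row
  `SourcedEnergyUpperRow t′ U μ h q L₁ (u − nμ)` AT the field give, by `PinFieldResponseFloorAt.of_energyRows`,
  the floor leaf `m ≤ m_L(μ; h)` for every `m` with `m·2h ≤ ℓ − u` — the `μ`-terms CANCEL: the floor
  `(ℓ − u)/(2h)` does not see `μ`, but the OBJECT does (it is the response of `A_L(μ, h)` at that `μ`).
* §3 The `(U, n, t′) = (8, 7/8, 0)` leaf at the tangent chemical potential of CERTIFIED row #473's certificate,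
  `μ₄₇₃ = 980464777135/2³⁹ ≈ 1.78345504` (its filling multiplier `(lam[0]+lam[1])/2`, kernel-checked in
  `Certificates/HubbardSquare_n4o5_lower_derived_ntangent_row499.lean`, `derived_r473_ntangent_slope_eq`), with
  the intercept `ℓ₄₇₃ = −1012151804787154021296135/2⁸⁰` (the endpoint of the #473 sentence): BOTH input rows are
  HYPOTHESES — the tangent floor `(ℓ₄₇₃ − (7/8)μ₄₇₃)·L² ≤ E₀(dWaveSourceTorus L 8 μ₄₇₃ 0)` is what #473's dual
  certifies for every large torus but is NOT the landed claim node `cert_r473_…` (that node is the ONE-density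
  thermodynamic-limit sentence `ℓ₄₇₃ ≤ energyDensityTT' 1 0 8 (7/8)` and implies nothing grand-canonical by
  itself), and the cap row is a producer's certificate (open-cluster mixture states, CQ-TABLE §B1-U). Output:
  `PinFieldResponseFloorAt 0 8 μ₄₇₃ h q (max L₀ L₁) m` whenever `m·2h ≤ ℓ₄₇₃ − u`
  (`u8_n7o8_tp0_responseFloorAt_tangent473_of_rows`); the tangent intercept in closed form
  `ℓ₄₇₃ − (7/8)μ₄₇₃ = −2898708545185443623774215/2⁸⁰ ≈ −2.3977555` (`tangent473_intercept_eq`). No `def`: the two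
  literals are written inline (nothing is claimed about them).

* §4 (appended) VECTOR / `hrows` forms: `groundEnergy_dWaveSourceTorusTT'_le_of_trialVector` (unit vector with rows
  `(n, e)` at `μ₀` ⇒ cap `(e + (μ₀ − μ)n)·L²` at every `μ`; `re_expect_dWaveSourceTorusTT'_mu_shift`), and
  `sourcedEnergyUpperRow_of_hrows[_self|_zero]`: the per-side trial-vector rows of the tiling bridge
  (`PairSourcedTorusTrialStateLimit.lean`'s `hrows` shape) give `SourcedEnergyUpperRow` at every rational `μ` — one
  producer theorem feeds both the canonical and the grand-canonical chain.

What is NOT here: no certificate is asserted (both rows are hypotheses; no `@[conjecture]` node); no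
thermodynamic-limit claim (the leaf is «every side `L ≥ max L₀ L₁` with `q ∣ L`»); no statement at `μ ≠ μ₄₇₃`
from #473 (the tangent floor holds at exactly one chemical potential per certificate); nothing about `h → 0`.

References: T. Koma, H. Tasaki, J. Stat. Phys. 76 (1994) 745, §1 (sourced ground energies, concavity in the
source) [cite: KomaTasaki1994, §1]; R. B. Griffiths, Phys. Rev. 152 (1966) 240, §II (chords of a concave
thermodynamic function bound the conjugate variable) [cite: Griffiths1966, §II]; D. Ruelle, *Statistical
Mechanics* (1969) §3.4 (grand-canonical function = Legendre transform in the density; a density multiplier is a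
chemical potential) [cite: Ruelle1969, §3.4]; H. Tasaki, *Physics and Mathematics of Quantum Many-Body Systems*
(2020) §2.1 (variational principle for density matrices) [cite: Tasaki2020, §2.1].
-/

noncomputable section

namespace Summit.Ventures.CertifiedManyBodySolver.Observables

open Matrix Literature.MathematicalPhysics.QuantumLattice Literature.Probability.LatticeModels
open Literature.Barriers.HubbardSuperconductivity (IsDensityMatrix)
open scoped ComplexOrder

/-! ### §1 A mean-density trial cap is `μ`-free -/

section MeanDensityCap

variable (L : ℕ) [NeZero L]

/-- **A trial state of mean density `n` caps the grand-canonical sourced energy at EVERY `μ`.** If `ρ` is a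
density matrix on the `L`-torus Fock space with `tr(ρ N) = n·L²` and `Re tr(ρ (H(1,t′,U) − h(Δ_d + Δ_d†))) ≤ u·L²`,
then `E₀(dWaveSourceTorusTT' L t′ U μ h) ≤ (u − n·μ)·L²` for every real `μ`
(`E₀(A) ≤ Re tr(ρA)` and `A_L(μ,h) = (H − hO) − μN`). [cite: Tasaki2020, §2.1] [cite: Ruelle1969, §3.4] -/
theorem groundEnergy_dWaveSourceTorusTT'_le_of_meanDensity_trial (tp U μ h : ℝ) {u n : ℝ}
    {ρ : Matrix (Finset (Orb (FermionTorus 2 L))) (Finset (Orb (FermionTorus 2 L))) ℂ}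
    (hρ : IsDensityMatrix ρ)
    (hN : (ρ * totalNumber).trace = ((n * (L : ℝ) ^ 2 : ℝ) : ℂ))
    (hE : (ρ * (hubbardTorusTT' L 1 tp U -
        (h : ℂ) • (pairField dWaveFormFactor L + (pairField dWaveFormFactor L)ᴴ))).trace.re ≤
          u * (L : ℝ) ^ 2) :
    (dWaveSourceTorusTT' L tp U μ h).groundEnergy ≤ (u - n * μ) * (L : ℝ) ^ 2 := by
  have hA := dWaveSourceTorusTT'_isHermitian L tp U μ h
  refine (groundEnergy_le_re_trace_mul_of_isDensityMatrix hA hρ).trans ?_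
  have hsplit : ρ * dWaveSourceTorusTT' L tp U μ h =
      ρ * (hubbardTorusTT' L 1 tp U -
          (h : ℂ) • (pairField dWaveFormFactor L + (pairField dWaveFormFactor L)ᴴ)) -
        (μ : ℂ) • (ρ * totalNumber) := by
    rw [dWaveSourceTorusTT'_eq, Matrix.mul_sub, Matrix.mul_sub, Matrix.mul_sub, Matrix.mul_smul]
    abel
  rw [hsplit, trace_sub, trace_smul, hN, Complex.sub_re, smul_eq_mul, ← Complex.ofReal_mul,
    Complex.ofReal_re]
  nlinarith [hE]

/-- **Row form** (rational `μ, u, n`, the literals of `Rows/SourcedTorusRows`): the same trial state gives the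
energy CEILING cell `SourcedTorusEnergyUpperRow L t′ U μ h (u − n·μ)` at every rational `μ`.
[cite: Tasaki2020, §2.1] [cite: Ruelle1969, §3.4] -/
theorem sourcedTorusEnergyUpperRow_of_meanDensity_trial (tp U h : ℝ) (μ : ℚ) {u n : ℚ}
    {ρ : Matrix (Finset (Orb (FermionTorus 2 L))) (Finset (Orb (FermionTorus 2 L))) ℂ}
    (hρ : IsDensityMatrix ρ)
    (hN : (ρ * totalNumber).trace = ((((n : ℚ) : ℝ) * (L : ℝ) ^ 2 : ℝ) : ℂ))
    (hE : (ρ * (hubbardTorusTT' L 1 tp U -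
        (h : ℂ) • (pairField dWaveFormFactor L + (pairField dWaveFormFactor L)ᴴ))).trace.re ≤
          ((u : ℚ) : ℝ) * (L : ℝ) ^ 2) :
    SourcedTorusEnergyUpperRow L tp U ((μ : ℚ) : ℝ) h (u - n * μ) := by
  rw [sourcedTorusEnergyUpperRow_iff]
  have key := groundEnergy_dWaveSourceTorusTT'_le_of_meanDensity_trial L tp U ((μ : ℚ) : ℝ) h hρ hN hE
  push_cast
  exact key

end MeanDensityCap

/-! ### §2 The tangent chord: the `μ`-terms cancel -/

section TangentChord

variable {tp U : ℝ} {q L₀ L₁ : ℕ}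

/-- **FLOOR chord at a tangent chemical potential.** A TANGENT floor row at `h = 0`,
`(ℓ − n·μ)·L² ≤ E₀(A_L(μ, 0))` (what a density-`n` certificate with filling multiplier `μ` says grand-canonically),
and a MEAN-DENSITY cap row AT the field, `E₀(A_L(μ, h)) ≤ (u − n·μ)·L²` (§1), give the response floor leaf
`m ≤ m_L(μ; h)` on every side `L ≥ max L₀ L₁`, `q ∣ L`, for every `m` with `m·2h ≤ ℓ − u`: the `μ`-terms cancel in
`PinFieldResponseFloorAt.of_energyRows`. The floor VALUE is `μ`-free; the OBJECT `m_L(μ; h)` is the response of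
the grand-canonical pinned torus at THIS `μ`. Teeth iff `u < ℓ`. [cite: KomaTasaki1994, §1] [cite: Griffiths1966, §II] -/
theorem PinFieldResponseFloorAt.of_tangentRow_of_meanDensityCap {h : ℝ} (hh : 0 < h) (μ : ℚ) {ℓ u n m : ℚ}
    (hlo : SourcedEnergyLowerRow tp U ((μ : ℚ) : ℝ) 0 q L₀ (ℓ - n * μ))
    (hhi : SourcedEnergyUpperRow tp U ((μ : ℚ) : ℝ) h q L₁ (u - n * μ))
    (hm : ((m : ℚ) : ℝ) * (2 * h) ≤ ℓ - u) :
    PinFieldResponseFloorAt tp U ((μ : ℚ) : ℝ) h q (max L₀ L₁) m := by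
  refine PinFieldResponseFloorAt.of_energyRows hh hlo hhi ?_
  push_cast
  rw [sub_zero]
  linarith

/-- The cancellation, spelled out: `(ℓ − nμ) − (u − nμ) = ℓ − u`. [folklore] -/
theorem tangentRow_sub_meanDensityCap (ℓ u n μ : ℚ) : (ℓ - n * μ) - (u - n * μ) = ℓ - u := by ring

end TangentChord

/-! ### §3 The `(8, 7/8, 0)` leaf at the tangent chemical potential of CERTIFIED row #473 -/

section Tangent473

/-- **The tangent intercept in closed form.** With `μ₄₇₃ = 980464777135/2³⁹ ≈ 1.78345504` the filling multiplier
`(lam[0] + lam[1])/2` of CERTIFIED #473's certificate (kernel-checked bookkeeping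
`Certificates.derived_r473_ntangent_slope_eq`) and `ℓ₄₇₃ = −1012151804787154021296135/2⁸⁰ ≈ −0.8372323499` the
endpoint of the #473 sentence (claim node `Certificates.cert_r473_bs_M3U8tp0_w3_b4_R2_ob5p2_kry1_kry2c3rel_hanK7B4D4_KN4_PR20d4_hanK8c2s_hanK8B4D4_uprime`;
literals only — nothing is claimed here): `ℓ₄₇₃ − (7/8)·μ₄₇₃ = −2898708545185443623774215/2⁸⁰ ≈ −2.3977555`, the
grand-canonical floor per site at `μ₄₇₃` that #473's dual certifies for the stationary translation-invariant states
of every density (`e(ω) − μ₄₇₃·ρ(ω) ≥ ℓ₄₇₃ − (7/8)μ₄₇₃`). Decidable, `norm_num`. [computation: exact ℚ arithmetic on certsdp-cert/0 literals] -/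
theorem tangent473_intercept_eq :
    (-1012151804787154021296135 / 1208925819614629174706176 : ℚ) - 7 / 8 * (980464777135 / 549755813888 : ℚ) =
      -2898708545185443623774215 / 2 ^ 80 := by
  norm_num

/-- Ten-digit outward prints: `1.7834550401 ≤ μ₄₇₃ < 1.7834550402` and
`−2.3977555101 ≤ ℓ₄₇₃ − (7/8)μ₄₇₃ < −2.3977555100`. Decidable, `norm_num`. [computation: exact ℚ arithmetic] -/
theorem tangent473_prints :
    (1.7834550401 : ℚ) ≤ (980464777135 / 549755813888 : ℚ) ∧
    (980464777135 / 549755813888 : ℚ) < 1.7834550402 ∧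
    (-2.3977555101 : ℚ) ≤ (-1012151804787154021296135 / 1208925819614629174706176 : ℚ) - 7 / 8 * (980464777135 / 549755813888 : ℚ) ∧
    (-1012151804787154021296135 / 1208925819614629174706176 : ℚ) - 7 / 8 * (980464777135 / 549755813888 : ℚ) < -2.3977555100 := by
  norm_num

/-- **The `(8, 7/8, 0)` RESPONSE-FLOOR LEAF at `μ₄₇₃ = 980464777135/2³⁹`** (CQ-TABLE §B1-U shape; BOTH rows are
HYPOTHESES). A tangent floor row of #473-type read grand-canonically at its own multiplier,
`hlo : SourcedEnergyLowerRow 0 8 μ₄₇₃ 0 q L₀ (ℓ₄₇₃ − (7/8)μ₄₇₃)` (i.e. `(ℓ₄₇₃ − (7/8)μ₄₇₃)·L² ≤ E₀(dWaveSourceTorusTT' L 0 8 μ₄₇₃ 0)`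
on every side `L ≥ L₀`, `q ∣ L` — NOT the landed one-density node `cert_r473_…`, which implies nothing here), and a
mean-density-`7/8` SOURCED cap row AT the field, `hhi : SourcedEnergyUpperRow 0 8 μ₄₇₃ h q L₁ (u − (7/8)μ₄₇₃)`
(§1: any density matrix of mean density `7/8` and sourced energy `≤ u·L²`, e.g. an open-cluster mixture), give
`PinFieldResponseFloorAt 0 8 μ₄₇₃ h q (max L₀ L₁) m` for every `m` with `m·2h ≤ ℓ₄₇₃ − u`: a floor on the
finite-field response `dWaveSourceDensityTT' L 0 8 μ₄₇₃ h` (= `dWaveSourceDensity L 8 μ₄₇₃ h`), positive iff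
`u < ℓ₄₇₃`. A RESPONSE floor at field `h`; not an order parameter, not a phase word, nothing at `h → 0`.
[cite: KomaTasaki1994, §1] [cite: Griffiths1966, §II] -/
theorem u8_n7o8_tp0_responseFloorAt_tangent473_of_rows {h : ℝ} (hh : 0 < h) {u m : ℚ} {q L₀ L₁ : ℕ}
    (hlo : SourcedEnergyLowerRow 0 8 ((980464777135 / 549755813888 : ℚ) : ℝ) 0 q L₀
      ((-1012151804787154021296135 / 1208925819614629174706176 : ℚ) - 7 / 8 * (980464777135 / 549755813888 : ℚ)))
    (hhi : SourcedEnergyUpperRow 0 8 ((980464777135 / 549755813888 : ℚ) : ℝ) h q L₁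
      (u - 7 / 8 * (980464777135 / 549755813888 : ℚ)))
    (hm : ((m : ℚ) : ℝ) * (2 * h) ≤ (-1012151804787154021296135 / 1208925819614629174706176 : ℚ) - u) :
    PinFieldResponseFloorAt 0 8 ((980464777135 / 549755813888 : ℚ) : ℝ) h q (max L₀ L₁) m :=
  PinFieldResponseFloorAt.of_tangentRow_of_meanDensityCap hh (980464777135 / 549755813888 : ℚ) hlo hhi hm

/-- The same leaf read on the `t′ = 0` objects of `DWaveSource.lean`: on every side `L ≥ max L₀ L₁` with `q ∣ L`,
`m ≤ dWaveSourceDensity L 8 μ₄₇₃ h` (`dWaveSourceDensityTT'_zero`). [cite: KomaTasaki1994, §1] -/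
theorem u8_n7o8_tp0_le_dWaveSourceDensity_tangent473_of_rows {h : ℝ} (hh : 0 < h) {u m : ℚ} {q L₀ L₁ : ℕ}
    (hlo : SourcedEnergyLowerRow 0 8 ((980464777135 / 549755813888 : ℚ) : ℝ) 0 q L₀
      ((-1012151804787154021296135 / 1208925819614629174706176 : ℚ) - 7 / 8 * (980464777135 / 549755813888 : ℚ)))
    (hhi : SourcedEnergyUpperRow 0 8 ((980464777135 / 549755813888 : ℚ) : ℝ) h q L₁
      (u - 7 / 8 * (980464777135 / 549755813888 : ℚ)))
    (hm : ((m : ℚ) : ℝ) * (2 * h) ≤ (-1012151804787154021296135 / 1208925819614629174706176 : ℚ) - u)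
    (L : ℕ) [NeZero L] (hL : max L₀ L₁ ≤ L) (hq : q ∣ L) :
    ((m : ℚ) : ℝ) ≤ dWaveSourceDensity L 8 ((980464777135 / 549755813888 : ℚ) : ℝ) h := by
  have key := u8_n7o8_tp0_responseFloorAt_tangent473_of_rows hh hlo hhi hm L hL hq
  rw [PinFieldTorusResponseFloor, dWaveSourceDensityTT'_zero] at key
  exact key

end Tangent473

/-! ### §4 (appended) Vector-state and `hrows`-shaped forms: ONE producer output feeds both chains -/

section VectorRows

open Literature.MathematicalPhysics.QuantumLattice.HubbardWave0

variable (L : ℕ) [NeZero L]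

/-- **`μ`-shift of the pinned torus**: `A_L(μ′, h) = A_L(μ, h) + (μ − μ′)·N` (definitional algebra on
`dWaveSourceTorusTT'_eq`). [cite: KomaTasaki1994, §1] -/
theorem dWaveSourceTorusTT'_mu_shift (tp U μ μ' h : ℝ) :
    dWaveSourceTorusTT' L tp U μ' h = dWaveSourceTorusTT' L tp U μ h + ((μ - μ' : ℝ) : ℂ) • totalNumber := by
  rw [dWaveSourceTorusTT'_eq, dWaveSourceTorusTT'_eq]
  push_cast
  module

/-- **The sourced trial energy is affine in `μ`**: `Re⟨ψ, A_L(μ′,h)ψ⟩ = Re⟨ψ, A_L(μ,h)ψ⟩ + (μ − μ′)·Re⟨ψ, Nψ⟩` for every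
torus vector `ψ` — «one state certifies the affine family». [cite: KomaTasaki1994, §1] -/
theorem re_expect_dWaveSourceTorusTT'_mu_shift (tp U μ μ' h : ℝ) (ψ : Fock (Orb (FermionTorus 2 L))) :
    (expect (dWaveSourceTorusTT' L tp U μ' h) ψ).re =
      (expect (dWaveSourceTorusTT' L tp U μ h) ψ).re + (μ - μ') * (expect totalNumber ψ).re := by
  rw [dWaveSourceTorusTT'_mu_shift L tp U μ μ' h]
  simp only [expect, Matrix.add_mulVec, dotProduct_add, Matrix.smul_mulVec, dotProduct_smul, smul_eq_mul,
    Complex.add_re, Complex.re_ofReal_mul]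

/-- **Trial VECTOR form of §1** (the shape the tiling producers emit): a unit torus vector `ψ` with number row
`Re⟨ψ,Nψ⟩ = n·L²` and sourced-energy row `Re⟨ψ, A_L(μ₀,h)ψ⟩ = e·L²` at SOME chemical potential `μ₀` caps the sourced
ground energy at EVERY `μ`: `E₀(A_L(μ,h)) ≤ (e + (μ₀ − μ)·n)·L²`. [cite: Tasaki2020, §2.1] [cite: Ruelle1969, §3.4] -/
theorem groundEnergy_dWaveSourceTorusTT'_le_of_trialVector (tp U μ₀ μ h : ℝ) {ψ : Fock (Orb (FermionTorus 2 L))}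
    (h1 : star ψ ⬝ᵥ ψ = 1) {n e : ℝ} (hN : (expect totalNumber ψ).re = n * (L : ℝ) ^ 2)
    (hE : (expect (dWaveSourceTorusTT' L tp U μ₀ h) ψ).re = e * (L : ℝ) ^ 2) :
    (dWaveSourceTorusTT' L tp U μ h).groundEnergy ≤ (e + (μ₀ - μ) * n) * (L : ℝ) ^ 2 := by
  have hray := Matrix.groundEnergy_le_rayleigh_holds (dWaveSourceTorusTT'_isHermitian L tp U μ h) ψ h1
  have hre : (star ψ ⬝ᵥ dWaveSourceTorusTT' L tp U μ h *ᵥ ψ).re = (e + (μ₀ - μ) * n) * (L : ℝ) ^ 2 := by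
    change (expect (dWaveSourceTorusTT' L tp U μ h) ψ).re = _
    rw [re_expect_dWaveSourceTorusTT'_mu_shift L tp U μ₀ μ h ψ, hN, hE]
    ring
  rwa [hre] at hray

variable {L}

/-- **`hrows` ⇒ cap ROW at every rational `μ`.** The per-side trial-vector rows of the tiling bridge (the literal shape
of `exists_isTranslationInvariant_density_eq_meanEnergy_sourced_eq_of_periodic_trialStates`, hubbard-cq-p2's
`PairSourcedTorusTrialStateLimit.lean`: on every side `L ≥ L₀` with `q ∣ L` a unit vector with rows `(n, e)` at `μ₀`)
give the energy CEILING row `SourcedEnergyUpperRow tp U μ h q L₀ (e + (μ₀ − μ)·n)` at EVERY rational `μ` — so ONE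
producer theorem feeds the canonical chain (p2) AND the grand-canonical chords (`PinFieldResponseFloorAt.of_energyRows`,
§2 above). [cite: Ruelle1969, §3.4] -/
theorem sourcedEnergyUpperRow_of_hrows (tp U h : ℝ) (μ₀ μ : ℚ) {q L₀ : ℕ} {n e : ℚ}
    (hrows : ∀ L : ℕ, q ∣ L → L₀ ≤ L → ∀ [NeZero L], ∃ ψ : Fock (Orb (FermionTorus 2 L)),
      star ψ ⬝ᵥ ψ = 1 ∧ (expect totalNumber ψ).re = ((n : ℚ) : ℝ) * (L : ℝ) ^ 2 ∧
        (expect (dWaveSourceTorusTT' L tp U ((μ₀ : ℚ) : ℝ) h) ψ).re = ((e : ℚ) : ℝ) * (L : ℝ) ^ 2) :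
    SourcedEnergyUpperRow tp U ((μ : ℚ) : ℝ) h q L₀ (e + (μ₀ - μ) * n) := by
  intro L _ hL hqL
  obtain ⟨ψ, h1, hN, hE⟩ := hrows L hqL hL
  rw [sourcedTorusEnergyUpperRow_iff]
  push_cast
  exact groundEnergy_dWaveSourceTorusTT'_le_of_trialVector L tp U ((μ₀ : ℚ) : ℝ) ((μ : ℚ) : ℝ) h h1 hN hE

/-- … at the producer's own `μ₀`: `SourcedEnergyUpperRow tp U μ₀ h q L₀ e`. [cite: Ruelle1969, §3.4] -/
theorem sourcedEnergyUpperRow_of_hrows_self (tp U h : ℝ) (μ₀ : ℚ) {q L₀ : ℕ} {n e : ℚ}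
    (hrows : ∀ L : ℕ, q ∣ L → L₀ ≤ L → ∀ [NeZero L], ∃ ψ : Fock (Orb (FermionTorus 2 L)),
      star ψ ⬝ᵥ ψ = 1 ∧ (expect totalNumber ψ).re = ((n : ℚ) : ℝ) * (L : ℝ) ^ 2 ∧
        (expect (dWaveSourceTorusTT' L tp U ((μ₀ : ℚ) : ℝ) h) ψ).re = ((e : ℚ) : ℝ) * (L : ℝ) ^ 2) :
    SourcedEnergyUpperRow tp U ((μ₀ : ℚ) : ℝ) h q L₀ e := by
  have key := sourcedEnergyUpperRow_of_hrows tp U h μ₀ μ₀ hrows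
  rwa [sub_self, zero_mul, add_zero] at key

/-- … from rows on the `μ = 0` pencil (the canonical-class producer's convention, `e = ⟨H − hO⟩/L²`): the mean-density
cap row `SourcedEnergyUpperRow tp U μ h q L₀ (e − μ·n)` of §1–§2 at every rational `μ`. [cite: Ruelle1969, §3.4] -/
theorem sourcedEnergyUpperRow_of_hrows_zero (tp U h : ℝ) (μ : ℚ) {q L₀ : ℕ} {n e : ℚ}
    (hrows : ∀ L : ℕ, q ∣ L → L₀ ≤ L → ∀ [NeZero L], ∃ ψ : Fock (Orb (FermionTorus 2 L)),
      star ψ ⬝ᵥ ψ = 1 ∧ (expect totalNumber ψ).re = ((n : ℚ) : ℝ) * (L : ℝ) ^ 2 ∧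
        (expect (dWaveSourceTorusTT' L tp U ((0 : ℚ) : ℝ) h) ψ).re = ((e : ℚ) : ℝ) * (L : ℝ) ^ 2) :
    SourcedEnergyUpperRow tp U ((μ : ℚ) : ℝ) h q L₀ (e - n * μ) := by
  have key := sourcedEnergyUpperRow_of_hrows tp U h 0 μ hrows
  rwa [zero_sub, neg_mul, ← sub_eq_add_neg, mul_comm] at key

end VectorRows

end Summit.Ventures.CertifiedManyBodySolver.Observables

end
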